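import Literature.AlgebraicGeometry.Morphisms.ProjectiveOfFibreSpan
import Literature.AlgebraicGeometry.Modules.PushforwardBaseChangeIsoOfFibreVanishingGeneralBase
import Literature.AlgebraicGeometry.Modules.VanishingLocusFiniteLocallyFree
import Literature.AlgebraicGeometry.Modules.ModuleCechComplex
import HarnessLib

/-!
# A frame of the direct image plus fibrewise embeddings make a proper flat morphism projective

Topic `AlgebraicGeometry/Morphisms`; namespace `Literature.AlgebraicGeometry.Morphisms`. THEOREMS ONLY (no definition, no named
fact, no instance, no `sorry`).

The FUNCTOR-SIDE assembly of EGA III 4.7.1 / Mumford §5 Cor. 3 in the currency of ★ `Morphisms/ProjectiveOfFibreSpan`: let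
`f : X → T` be a morphism, `E` an `𝒪_X`-module and `e : 𝒪_T^ι ≅ f_*E` a (global) FRAME of the direct image, with basis sections
`b_i ∈ Γ(T, f_*E) = Γ(X, E)`.

* §1 (pure, any universe) `span_secMod_unitSectionLE_eq_top_of_frame_of_surjective` — for ANY commutative square
  `iX ≫ f = f₀ ≫ iK` over `Spec K` whose base-change morphism `β : iK^*(f_*E) → f₀_*(iX^*E)` (★ `Modules/PushforwardBaseChangeHom`)
  is onto on global sections, the restricted sections `η_{iX}(b_i)` SPAN `Γ(X₀, iX^*E)` over `Γ(Spec K, 𝒪)`: the pulled-back frame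
  `pullbackFrame iK e` spans `Γ(iK^*f_*E)` (★ `eq_sum_coord_smul`) and `β(η_{iK}(b_i)) = η_{iX}(b_i)`
  (★ `pushforwardBaseChangeHom_app_unitSectionLE`); `…_of_isIso` when `β` is an isomorphism.
* §2 `span_secMod_unitSectionLE_eq_top_of_frame_of_forall_fieldPoint` — for `T` locally noetherian, `f` proper flat, `E` finite
  locally free with `Ext¹(𝒪, E|fibre) = 0` on every fibre over a field point, `β` IS an isomorphism for every cartesian square
  (★ G10 `Modules.isIso_pushforwardBaseChangeHom_of_forall_fieldPoint`, the framed `f_*E` being affine-localizing), so §1 applies: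
  this is the `hs` clause of ★ `isProjective_of_fibres_span`, for EVERY section of the fibre.
* §3 `iSup_basicOpen_coeffAt_eq_top_of_pushforwardFrame`, `isClosedImmersion_toProj_comap_of_pushforwardFrame`,
  **`isProjective_of_pushforwardFrame`**, `isClosedImmersion_pointOfSections_of_pushforwardFrame` — with `E` carrying a rank-one
  frame system: if every `t ∈ T` has a fibre presentation (any cartesian square over some `Spec K → T` through which `Spec κ(t)`
  factors) whose fibre is generated and EMBEDDED by some sections of `iX^*E` (the complete linear system of the fibre), then the
  frame sections `b_j` generate `E`, embed every presented fibre, `X → 𝐏(ι; T)` is a closed immersion and `f` is PROJECTIVE.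

Cell `hodgecm-mathlib`, F-6 functor side (FS-a) (B-p20 (g11)); (FS-b) instantiates it for polarized abelian schemes with level
structure. Count-neutral (HC_CM is proved only modulo the 7 printed citations until rung 0 closes).

## References
* A. Grothendieck, J. Dieudonné, *EGA III₁* (Publ. Math. IHÉS 11, 1961), Thm. 4.7.1. [EGAIII1]
* D. Mumford, *Abelian Varieties* (1970), §5 Cor. 3 (p. 53). [MumfordAV1970]
* R. Hartshorne, *Algebraic Geometry* (1977), III Prop. 9.3 (Remark 9.3.1), III Thm. 12.11 (p. 290), II §4 Definition p.103
  (projective morphism). [Hartshorne1977]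
-/

noncomputable section

-- `TopCat.Presheaf`/`Scheme.Modules` and pull-back bookkeeping (as in ★ `Morphisms/ProjectiveOfFibreSpan`).
set_option backward.isDefEq.respectTransparency false

universe u

open CategoryTheory CategoryTheory.Limits CategoryTheory.Abelian AlgebraicGeometry TopologicalSpace Opposite
open Literature.AlgebraicGeometry.Modules
open Literature.AlgebraicGeometry.Motives Literature.AlgebraicGeometry.Motives.GeneratingSections
open Literature.AlgebraicGeometry.Motives.Segre

namespace Literature.AlgebraicGeometry.Morphisms

/-! ## §1 A frame of `f_*E` and a surjective base-change map make the restricted frame sections span the fibre -/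

section Frame

variable {X T X₀ : Scheme.{u}} (f : X ⟶ T) {K : Type u} [CommRing K] (iK : Spec (.of K) ⟶ T) (iX : X₀ ⟶ X)
  (f₀ : X₀ ⟶ Spec (.of K)) (w : iX ≫ f = f₀ ≫ iK) (E : X.Modules) {ι : Type u} [Fintype ι]
  (e : SheafOfModules.free ι ≅ ((Scheme.Modules.pushforward f).obj E).over ⊤)

/-- The `Γ(Spec K, 𝒪)`-action on `Γ(Spec K, f₀_*N) = Γ(X₀, N)` (restriction of scalars along `f₀^♯`, Mathlib
`Scheme.Modules.pushforward`) is the action through `f₀^♯ : Γ(Spec K, 𝒪) → Γ(X₀, 𝒪)` of ★ `SecMod N f₀.appTop.hom ⊤`.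
[cite: Hartshorne1977, III Prop. 9.3 (Remark 9.3.1)] -/
theorem secMod_mk_pushforward_smul (N : X₀.Modules) (r : Γ(Spec (.of K), ⊤))
    (n : Γ((Scheme.Modules.pushforward f₀).obj N, ⊤)) :
    SecMod.mk (L := N) (ρ := f₀.appTop.hom) (U := ⊤) (show Γ(N, ⊤) from r • n) =
      r • SecMod.mk (L := N) (ρ := f₀.appTop.hom) (U := ⊤) (show Γ(N, ⊤) from n) := by
  apply SecMod.val_injective
  rw [SecMod.smul_def]
  simp only [SecMod.val_mk]
  have h : toSections f₀.appTop.hom ⊤ r = f₀.app ⊤ r := by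
    change X₀.presheaf.map (homOfLE le_top).op (f₀.appTop r) = _
    have h1 : homOfLE (le_top : (⊤ : X₀.Opens) ≤ ⊤) = 𝟙 _ := Subsingleton.elim _ _
    rw [h1, op_id, X₀.presheaf.map_id]
    rfl
  rw [h]
  rfl

omit [Fintype ι] in
include w in
/-- **`β(η_{iK}(b_i)) = η_{iX}(b_i)`** on global sections, for the base-change morphism `β` of the square `iX ≫ f = f₀ ≫ iK`
(★ `pushforwardBaseChangeHom_app_unitSectionLE` at `V = W = ⊤`). [cite: Hartshorne1977, III Prop. 9.3 (Remark 9.3.1)] -/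
theorem pushforwardBaseChangeHom_app_top_unitSectionLE_basisSection (i : ι) :
    (pushforwardBaseChangeHom w E).app ⊤
        (unitSectionLE iK ((Scheme.Modules.pushforward f).obj E) (V := ⊤) (U := ⊤) le_top (basisSection e i :)) =
      (show Γ((Scheme.Modules.pullback iX).obj E, ⊤) from
        unitSectionLE iX E (V := ⊤) (U := ⊤) le_top (basisSection e i :)) :=
  pushforwardBaseChangeHom_app_unitSectionLE w E (V := ⊤) (W := ⊤) le_top (basisSection e i :)

include w in
/-- **A frame of `f_*E` and a base-change map onto on global sections make the restricted frame sections SPAN the fibre**: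
if `β : iK^*(f_*E) → f₀_*(iX^*E)` is surjective on `Γ(Spec K, –)`, then `Γ(X₀, iX^*E)` is spanned over `Γ(Spec K, 𝒪)` by the
`η_{iX}(b_i)` (`b_i` the basis sections of the frame `e`): every section is `β` of a section of the free module `iK^*(f_*E)`,
i.e. of a combination of the `η_{iK}(b_i)` (★ `eq_sum_coord_smul` for ★ `pullbackFrame iK e`), and `β(η_{iK}(b_i)) = η_{iX}(b_i)`.
[cite: MumfordAV1970, §5 Cor. 3 (p. 53)] [cite: Hartshorne1977, III Prop. 9.3 (Remark 9.3.1)] -/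
theorem span_secMod_unitSectionLE_eq_top_of_frame_of_surjective
    (hβ : Function.Surjective ((pushforwardBaseChangeHom w E).app ⊤)) :
    Submodule.span Γ(Spec (.of K), ⊤) (Set.range fun i : ι ↦
      SecMod.mk (L := (Scheme.Modules.pullback iX).obj E) (ρ := f₀.appTop.hom) (U := ⊤)
        (unitSectionLE iX E (V := ⊤) (U := ⊤) le_top (basisSection e i :))) = ⊤ := by
  refine Submodule.eq_top_iff'.mpr fun y ↦ ?_
  obtain ⟨u, hu⟩ := hβ (show Γ((Scheme.Modules.pushforward f₀).obj ((Scheme.Modules.pullback iX).obj E), ⊤) from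
    (SecMod.val y :))
  -- expand `u` in the pulled-back frame
  have hexp := eq_sum_coord_smul (pullbackFrame iK e)
    (homOfLE (le_top : (⊤ : (Spec (.of K)).Opens) ≤ iK ⁻¹ᵁ ⊤)) u
  simp only [basisSection_pullbackFrame] at hexp
  -- the restricted pulled-back basis sections are the `η_{iK}(b_i)|_⊤`
  replace hexp : u = ∑ i, coord (pullbackFrame iK e) (homOfLE le_top) u i •
      unitSectionLE iK ((Scheme.Modules.pushforward f).obj E) (V := ⊤) (U := ⊤) le_top (basisSection e i :) := hexp
  have hy : y = SecMod.mk (L := (Scheme.Modules.pullback iX).obj E) (ρ := f₀.appTop.hom) (U := ⊤)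
      (show Γ((Scheme.Modules.pullback iX).obj E, ⊤) from (pushforwardBaseChangeHom w E).app ⊤ u) := by
    rw [hu]; rfl
  rw [hy, hexp, map_sum]
  simp only [Scheme.Modules.Hom.app_smul, pushforwardBaseChangeHom_app_top_unitSectionLE_basisSection]
  change ∑ i, SecMod.mk (L := (Scheme.Modules.pullback iX).obj E) (ρ := f₀.appTop.hom) (U := ⊤) _ ∈ _
  refine Submodule.sum_mem _ fun i _ ↦ ?_
  rw [secMod_mk_pushforward_smul]
  exact Submodule.smul_mem _ _ (Submodule.subset_span ⟨i, rfl⟩)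

include w in
/-- **Isomorphism form**: if the base-change morphism `β : iK^*(f_*E) → f₀_*(iX^*E)` is an isomorphism (cohomology and base
change), the restricted frame sections `η_{iX}(b_i)` span `Γ(X₀, iX^*E)` over `Γ(Spec K, 𝒪)`.
[cite: MumfordAV1970, §5 Cor. 3 (p. 53)] [cite: Hartshorne1977, III Prop. 9.3 (Remark 9.3.1)] -/
theorem span_secMod_unitSectionLE_eq_top_of_frame_of_isIso [IsIso (pushforwardBaseChangeHom w E)] :
    Submodule.span Γ(Spec (.of K), ⊤) (Set.range fun i : ι ↦
      SecMod.mk (L := (Scheme.Modules.pullback iX).obj E) (ρ := f₀.appTop.hom) (U := ⊤)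
        (unitSectionLE iX E (V := ⊤) (U := ⊤) le_top (basisSection e i :))) = ⊤ := by
  refine span_secMod_unitSectionLE_eq_top_of_frame_of_surjective f iK iX f₀ w E e fun y ↦ ?_
  refine ⟨(inv (pushforwardBaseChangeHom w E)).app ⊤ y, ?_⟩
  rw [← CategoryTheory.comp_apply, ← Scheme.Modules.Hom.comp_app, IsIso.inv_hom_id, Scheme.Modules.Hom.id_app]
  rfl

include e in
/-- **A global frame makes `f_*E` finite locally free.** [cite: Hartshorne1977, III Prop. 9.3 (Remark 9.3.1)] -/
theorem isFiniteLocallyFree_pushforward_of_frame :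
    IsFiniteLocallyFree ((Scheme.Modules.pushforward f).obj E) :=
  fun _ ↦ ⟨⊤, trivial, ι, inferInstance, ⟨e⟩⟩

end Frame

/-! ## §2 Proper flat `f`, fibrewise `Ext¹ = 0`: the base-change map is an isomorphism, so the frame sections span every fibre -/

section FieldPoints

variable {X T X₀ : Scheme.{0}} [IsLocallyNoetherian T] (f : X ⟶ T) [IsProper f] [Flat f] (E : X.Modules)
  (hL : IsFiniteLocallyFree E) {ι : Type} [Fintype ι]
  (e : SheafOfModules.free ι ≅ ((Scheme.Modules.pushforward f).obj E).over ⊤)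
  (hvan : ∀ ⦃K : Type⦄ [Field K] ⦃X₀ : Scheme.{0}⦄ (i : X₀ ⟶ X) (f₀ : X₀ ⟶ Spec (CommRingCat.of K))
    (x : Spec (CommRingCat.of K) ⟶ T), IsPullback i f₀ f x →
      Subsingleton (Ext.{1} (unitModule X₀) ((Scheme.Modules.pullback i).obj E) 1))
  {K : Type} [CommRing K] {iK : Spec (.of K) ⟶ T} {iX : X₀ ⟶ X} {f₀ : X₀ ⟶ Spec (.of K)} (HX : IsPullback iX f₀ f iK)

include e hL hvan in
/-- **Cohomology and base change for the framed `f_*E`**: for `T` locally noetherian, `f` proper flat, `E` finite locally free with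
`Ext¹(𝒪, E|_{X₀}) = 0` on every fibre over a field point, and `f_*E` framed (hence affine-localizing), the base-change morphism
of EVERY cartesian square `X₀ = X ×_T Spec K` is an isomorphism (★ G10 `Modules.isIso_pushforwardBaseChangeHom_of_forall_fieldPoint`).
[cite: MumfordAV1970, §5 Cor. 3 (p. 53)] [cite: Hartshorne1977, III Thm. 12.11 (p. 290)] -/
theorem isIso_pushforwardBaseChangeHom_of_frame_of_forall_fieldPoint : IsIso (pushforwardBaseChangeHom HX.w E) :=
  isIso_pushforwardBaseChangeHom_of_forall_fieldPoint E hL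
    (isAffineLocalizing_of_isFiniteLocallyFree (isFiniteLocallyFree_pushforward_of_frame f E e)) hvan HX

include hL hvan HX in
/-- **The restricted frame sections span every fibre** (`T` locally noetherian, `f` proper flat, `E` finite locally free with
fibrewise `Ext¹(𝒪, E|fibre) = 0` over field points, `e` a frame of `f_*E`): for EVERY cartesian square `X₀ = X ×_T Spec K`
(`K` any commutative ring), `Γ(X₀, iX^*E)` is spanned over `Γ(Spec K, 𝒪)` by the `η_{iX}(b_i)` — the `hs` clause of
★ `isProjective_of_fibres_span`, for every section of the fibre. [cite: MumfordAV1970, §5 Cor. 3 (p. 53)]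
[cite: Hartshorne1977, III Thm. 12.11 (p. 290)] -/
theorem span_secMod_unitSectionLE_eq_top_of_frame_of_forall_fieldPoint :
    Submodule.span Γ(Spec (.of K), ⊤) (Set.range fun i : ι ↦
      SecMod.mk (L := (Scheme.Modules.pullback iX).obj E) (ρ := f₀.appTop.hom) (U := ⊤)
        (unitSectionLE iX E (V := ⊤) (U := ⊤) le_top (basisSection e i :))) = ⊤ := by
  haveI := isIso_pushforwardBaseChangeHom_of_frame_of_forall_fieldPoint f E hL e hvan HX
  exact span_secMod_unitSectionLE_eq_top_of_frame_of_isIso f iK iX f₀ HX.w E e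

include hL hvan HX in
/-- **Membership form** (the literal `hs` clause of ★ `isProjective_of_fibres_span`): every section of `iX^*E` over `X₀` lies in
the `Γ(Spec K, 𝒪)`-span of the restricted frame sections. [cite: MumfordAV1970, §5 Cor. 3 (p. 53)]
[cite: Hartshorne1977, III Thm. 12.11 (p. 290)] -/
theorem secMod_mk_mem_span_unitSectionLE_of_frame_of_forall_fieldPoint
    (s : Γ((Scheme.Modules.pullback iX).obj E, ⊤)) :
    SecMod.mk (L := (Scheme.Modules.pullback iX).obj E) (ρ := f₀.appTop.hom) (U := ⊤) s ∈
      Submodule.span Γ(Spec (.of K), ⊤) (Set.range fun i : ι ↦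
        SecMod.mk (L := (Scheme.Modules.pullback iX).obj E) (ρ := f₀.appTop.hom) (U := ⊤)
          (unitSectionLE iX E (V := ⊤) (U := ⊤) le_top (basisSection e i :))) := by
  rw [span_secMod_unitSectionLE_eq_top_of_frame_of_forall_fieldPoint f E hL e hvan HX]
  exact Submodule.mem_top

end FieldPoints

/-! ## §3 Rank-one `E`: the frame sections generate, embed every presented fibre, and `f` is projective -/

section Projective

variable {X T : Scheme.{0}} [IsLocallyNoetherian T] (f : X ⟶ T) [IsProper f] [Flat f] {E : X.Modules}
  (F : FrameSystem E) (h1 : ∀ x, F.rank x = 1) {m : ℕ}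
  (e : SheafOfModules.free (Fin (m + 1)) ≅ ((Scheme.Modules.pushforward f).obj E).over ⊤)
  (hvan : ∀ ⦃K : Type⦄ [Field K] ⦃X₀ : Scheme.{0}⦄ (i : X₀ ⟶ X) (f₀ : X₀ ⟶ Spec (CommRingCat.of K))
    (x : Spec (CommRingCat.of K) ⟶ T), IsPullback i f₀ f x →
      Subsingleton (Ext.{1} (unitModule X₀) ((Scheme.Modules.pullback i).obj E) 1))

include hvan in
/-- **Every presented fibre is embedded by the FRAME sections** (`T` locally noetherian, `f` proper flat, `F` a rank-one frame
system of `E` with fibrewise `Ext¹(𝒪, E|fibre) = 0`, `e : 𝒪^{m+1} ≅ f_*E` a frame): for a cartesian square `X₀ = X ×_T Spec K`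
whose fibre `iX^*E` is generated by sections `s₀,…,sₙ` embedding `X₀ ↪ ℙⁿ_K`, the frame sections `b_j` generate `E` along `iX`
and their restrictions embed `X₀ ↪ ℙ^m_K` (★ `isClosedImmersion_toProj_comap_of_span`, its `hs` clause paid by §2).
[cite: EGAIII1, Thm. 4.7.1] [cite: MumfordAV1970, §5 Cor. 3 (p. 53)] -/
theorem isClosedImmersion_toProj_comap_of_pushforwardFrame {K : Type} [CommRing K] {iK : Spec (.of K) ⟶ T}
    {X₀ : Scheme.{0}} {iX : X₀ ⟶ X} {f₀ : X₀ ⟶ Spec (.of K)} (HX : IsPullback iX f₀ f iK)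
    (h1₀ : ∀ x, (F.pullback iX).rank x = 1) {n : ℕ} (s : Fin (n + 1) → Γ((Scheme.Modules.pullback iX).obj E, ⊤))
    (hcov : ⨆ i, ⨆ x, X₀.basicOpen ((CocycleSections.ofFrameSystem (F.pullback iX) h1₀ s).coeff i x) = ⊤)
    (Hemb : IsClosedImmersion ((ofCocycleSections (F.pullback iX).U
      (CocycleSections.ofFrameSystem (F.pullback iX) h1₀ s) hcov).toProj f₀)) :
    (∀ y : X₀, ∃ j, iX y ∈ X.basicOpen (GeneratingSections.coeffAt F h1 (fun j ↦ (basisSection e j :)) j (iX y))) ∧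
      ∃ hcov₀, IsClosedImmersion ((ofCocycleSections (fun a ↦ iX ⁻¹ᵁ F.U a)
        ((CocycleSections.ofFrameSystem F h1 fun j ↦ (basisSection e j :)).comap iX) hcov₀).toProj f₀) := by
  haveI : IsProper f₀ := MorphismProperty.of_isPullback HX inferInstance
  exact isClosedImmersion_toProj_comap_of_span iX f₀ F h1 h1₀ s hcov Hemb (fun j ↦ (basisSection e j :)) fun i ↦
    secMod_mk_mem_span_unitSectionLE_of_frame_of_forall_fieldPoint f E F.isFiniteLocallyFree e hvan HX (s i)

variable
  (H : ∀ t : T, ∃ (K : Type) (_ : CommRing K) (iK : Spec (.of K) ⟶ T) (σ : Spec (T.residueField t) ⟶ Spec (.of K))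
    (_ : σ ≫ iK = T.fromSpecResidueField t) (X₀ : Scheme.{0}) (iX : X₀ ⟶ X) (f₀ : X₀ ⟶ Spec (.of K))
    (_ : IsPullback iX f₀ f iK) (h1₀ : ∀ x, (F.pullback iX).rank x = 1) (n : ℕ)
    (s : Fin (n + 1) → Γ((Scheme.Modules.pullback iX).obj E, ⊤))
    (hcov : ⨆ i, ⨆ x, X₀.basicOpen ((CocycleSections.ofFrameSystem (F.pullback iX) h1₀ s).coeff i x) = ⊤),
    IsClosedImmersion ((ofCocycleSections (F.pullback iX).U
      (CocycleSections.ofFrameSystem (F.pullback iX) h1₀ s) hcov).toProj f₀))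

include hvan H in
/-- The fibre presentations of `H`, completed by the `hs` clause of §2 (the shape ★ `isProjective_of_fibres_span` consumes).
[cite: EGAIII1, Thm. 4.7.1] [cite: MumfordAV1970, §5 Cor. 3 (p. 53)] -/
theorem fibres_span_of_pushforwardFrame (t : T) :
    ∃ (K : Type) (_ : CommRing K) (iK : Spec (.of K) ⟶ T) (σ : Spec (T.residueField t) ⟶ Spec (.of K))
    (_ : σ ≫ iK = T.fromSpecResidueField t) (X₀ : Scheme.{0}) (iX : X₀ ⟶ X) (f₀ : X₀ ⟶ Spec (.of K))
    (_ : IsPullback iX f₀ f iK) (h1₀ : ∀ x, (F.pullback iX).rank x = 1) (n : ℕ)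
    (s : Fin (n + 1) → Γ((Scheme.Modules.pullback iX).obj E, ⊤))
    (hcov : ⨆ i, ⨆ x, X₀.basicOpen ((CocycleSections.ofFrameSystem (F.pullback iX) h1₀ s).coeff i x) = ⊤)
    (_ : IsClosedImmersion ((ofCocycleSections (F.pullback iX).U
      (CocycleSections.ofFrameSystem (F.pullback iX) h1₀ s) hcov).toProj f₀)),
    ∀ i, SecMod.mk (L := (Scheme.Modules.pullback iX).obj E) (ρ := f₀.appTop.hom) (U := ⊤) (s i) ∈
      Submodule.span Γ(Spec (.of K), ⊤) (Set.range fun j ↦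
        SecMod.mk (L := (Scheme.Modules.pullback iX).obj E) (ρ := f₀.appTop.hom) (U := ⊤)
          (unitSectionLE iX E (V := ⊤) (U := ⊤) le_top (basisSection e j :))) := by
  obtain ⟨K, _, iK, σ, hσ, X₀, iX, f₀, HX, h1₀, n, s, hcov, Hemb⟩ := H t
  exact ⟨K, inferInstance, iK, σ, hσ, X₀, iX, f₀, HX, h1₀, n, s, hcov, Hemb, fun i ↦
    secMod_mk_mem_span_unitSectionLE_of_frame_of_forall_fieldPoint f E F.isFiniteLocallyFree e hvan HX (s i)⟩

include hvan H in
/-- **The frame sections generate `E` everywhere** (every point lies on a presented fibre, embedded by §3's first theorem).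
[cite: EGAIII1, Thm. 4.7.1] [cite: MumfordAV1970, §5 Cor. 3 (p. 53)] -/
theorem iSup_basicOpen_coeffAt_eq_top_of_pushforwardFrame :
    ⨆ j, ⨆ x, X.basicOpen (GeneratingSections.coeffAt F h1 (fun j ↦ (basisSection e j :)) j x) = ⊤ :=
  iSup_basicOpen_coeffAt_eq_top_of_fibres_span f F h1 (fun j ↦ (basisSection e j :))
    (fibres_span_of_pushforwardFrame f F e hvan H)

include h1 e hvan H in
/-- **EGA III 4.7.1 / Mumford §5 Cor. 3, functor side: a FRAME of `f_*E` plus fibrewise complete-linear-system embeddings make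
`f` PROJECTIVE.** `T` locally noetherian, `f : X → T` proper flat, `E` an `𝒪_X`-module with a rank-one frame system and
`Ext¹(𝒪, E|fibre) = 0` on every fibre over a field point, `e : 𝒪_T^{m+1} ≅ f_*E` a frame; if every `t ∈ T` has a fibre
presentation `X₀ = X ×_T Spec K` (any cartesian square over some `Spec K → T` through which `Spec κ(t)` factors) with sections of
`iX^*E` generating it and embedding `X₀ ↪ ℙⁿ_K`, then the frame sections `b₀,…,b_m` embed `X ↪ 𝐏^m_T` over `T`: `f` is projective
(★ `isProjective_of_fibres_span`, its `hs` clause paid by cohomology and base change §2).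
[cite: EGAIII1, Thm. 4.7.1] [cite: MumfordAV1970, §5 Cor. 3 (p. 53)] [cite: Hartshorne1977, II §4 Definition p.103 (projective morphism)] -/
theorem isProjective_of_pushforwardFrame : AlgebraicGeometry.Morphisms.IsProjective f :=
  isProjective_of_fibres_span f F h1 (fun j ↦ (basisSection e j :)) (fibres_span_of_pushforwardFrame f F e hvan H)

end Projective

/-! ## §4 The closed immersion `X ↪ 𝐏(ι; T)` of the frame sections -/

section PointOfSections

variable {X T : Scheme.{0}} [IsLocallyNoetherian T] (f : X ⟶ T) [IsProper f] [Flat f] {E : X.Modules}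
  (F : FrameSystem E) (h1 : ∀ x, F.rank x = 1) (ι : Type)
  (e : SheafOfModules.free (Fin (Nat.card ι + 1)) ≅ ((Scheme.Modules.pushforward f).obj E).over ⊤)
  (hvan : ∀ ⦃K : Type⦄ [Field K] ⦃X₀ : Scheme.{0}⦄ (i : X₀ ⟶ X) (f₀ : X₀ ⟶ Spec (CommRingCat.of K))
    (x : Spec (CommRingCat.of K) ⟶ T), IsPullback i f₀ f x →
      Subsingleton (Ext.{1} (unitModule X₀) ((Scheme.Modules.pullback i).obj E) 1))
  (H : ∀ t : T, ∃ (K : Type) (_ : CommRing K) (iK : Spec (.of K) ⟶ T) (σ : Spec (T.residueField t) ⟶ Spec (.of K))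
    (_ : σ ≫ iK = T.fromSpecResidueField t) (X₀ : Scheme.{0}) (iX : X₀ ⟶ X) (f₀ : X₀ ⟶ Spec (.of K))
    (_ : IsPullback iX f₀ f iK) (h1₀ : ∀ x, (F.pullback iX).rank x = 1) (n : ℕ)
    (s : Fin (n + 1) → Γ((Scheme.Modules.pullback iX).obj E, ⊤))
    (hcov : ⨆ i, ⨆ x, X₀.basicOpen ((CocycleSections.ofFrameSystem (F.pullback iX) h1₀ s).coeff i x) = ⊤),
    IsClosedImmersion ((ofCocycleSections (F.pullback iX).U
      (CocycleSections.ofFrameSystem (F.pullback iX) h1₀ s) hcov).toProj f₀))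

include hvan H in
/-- **The frame sections define a CLOSED IMMERSION `X ↪ 𝐏(ι; T)` over `T`** (frame indexed by the `#ι + 1` homogeneous
coordinates; ★ `isClosedImmersion_pointOfSections_of_isPullback` fed by §3 on every presented fibre).
[cite: EGAIII1, Thm. 4.7.1] [cite: MumfordAV1970, §5 Cor. 3 (p. 53)] [cite: Hartshorne1977, II §4 Definition p.103 (projective morphism)] -/
theorem isClosedImmersion_pointOfSections_of_pushforwardFrame :
    IsClosedImmersion (projectiveSpace.pointOfSections (Over.mk f)
      (ofCocycleSections F.U (CocycleSections.ofFrameSystem F h1 fun j ↦ (basisSection e j :))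
        (iSup_basicOpen_coeffAt_eq_top_of_pushforwardFrame f F h1 e hvan H))).left := by
  refine isClosedImmersion_pointOfSections_of_isPullback f ι _ fun t ↦ ?_
  obtain ⟨K, _, iK, σ, hσ, X₀, iX, f₀, HX, h1₀, n, s, hcov, Hemb⟩ := H t
  obtain ⟨-, hcov₀, H₀⟩ := isClosedImmersion_toProj_comap_of_pushforwardFrame f F h1 e hvan HX h1₀ s hcov Hemb
  refine ⟨K, inferInstance, iK, σ, hσ, X₀, iX, f₀, HX, ?_⟩
  rw [← ofCocycleSections_comap iX (CocycleSections.ofFrameSystem F h1 fun j ↦ (basisSection e j :))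
    (iSup_basicOpen_coeffAt_eq_top_of_pushforwardFrame f F h1 e hvan H)]
  exact H₀

end PointOfSections

end Literature.AlgebraicGeometry.Morphisms

end
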